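import Summits.KontsevichZagierPeriods.KontsevichZagierPeriods.Theses.LinRedNormalForm
import Literature.NumberTheory.Transcendental.MultipleZetaValuesHoffmanProofs
import Literature.NumberTheory.Transcendental.MultipleZetaRepeatedTwosProofs
import Literature.NumberTheory.Transcendental.LindemannWeierstrassProofs
import Literature.NumberTheory.Transcendental.MultipleZetaValuesProofs

/-!
# Disproof of `HoffmanIndependence` — findings (cdisprove, cycle 1, 2026-08-16)

Crux `stmt-KontsevichZagierPeriods-15045` =
`Summit.KontsevichZagierPeriods.KontsevichZagierPeriods.Theses.LinRedNormalForm.HoffmanIndependence`: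
`LinearIndependent ℚ (fun u : {u : List ℕ // MZV.IsHoffman u} => multipleZeta u.1)` — the real
Hoffman values `ζ(u)`, `u ∈ {2,3}^×` (all weights, `ζ(∅) = 1` included), are `ℚ`-linearly independent.

VERDICT OF THIS CYCLE: **no kill; not killable here.** The statement has no hypotheses, no parameters,
no coercion or junk-value traps (every Hoffman index is admissible, so every member is a genuinely
convergent `tsum`, positive; no duplicate member short of a counterexample to the period conjecture),
and `¬ HoffmanIndependence` is itself an open transcendence statement (one `ℚ`-relation among real
Hoffman MZVs; none below height `10^33` among the 48 values of weight `≤ 12`, rattack job j015325).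
What this file records instead, all `sorry`-free unless marked NEAR-MISS:

* §A LOAD-BEARING ANALYSIS = ALPHABET MUTATIONS (the only "hypothesis" is the index set `{2,3}^×`):
  - `not_linearIndependent_admissible` — relaxing `IsHoffman` to `IsAdmissible` is FALSE (`ζ(2,1) = ζ(3)`);
  - `not_linearIndependent_entries_ge_two` — relaxing `{2,3}` to "all entries `≥ 2`" is FALSE
    (`4ζ(2,2) = 3ζ(4)`, weight 4);
  - `not_linearIndependent_two_four` — trading the letter `3` for `4` is FALSE (same witness);
  - `not_linearIndependent_one_two` — the mirror alphabet `{1,2}` (admissible words) is FALSE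
    (`3ζ(2,1,1) = 4ζ(2,2)`).
  - `hoffmanIndependence_false_algebraic` — the multiplicative strengthening (ALGEBRAIC independence
    of the Hoffman values over ℚ) is FALSE in weight 4 (`ζ(2)² = (10/3)ζ(2,2)`): the crux is a
    linear basis claim and no stronger (products are rewritten by the (quasi-)shuffle relations).
  So `{2,3}` is load-bearing in every direction tried: any proof must use BOTH "no letter 1" and
  "no letter ≥ 4".
* §B TIGHTNESS / BOUNDARY:
  - `not_linearIndependent_hoffman_insert` — the family cannot be enlarged by ANY admissible
    non-Hoffman index of weight `≤ 9` (Brown's theorem is unconditional there in the tree,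
    `hoffmanSpan_eq_mzvSpace_of_le_nine`): the crux asserts a maximal independent family = a basis;
  - `linearIndependent_multipleZeta_replicate_two` — the diagonal sub-family `u ∈ {2}^×` IS
    independent (Lindemann, `transcendental_pi_holds`; `ζ({2}ⁿ) = π²ⁿ/(2n+1)!`). This is the largest
    sub-family provable with the tree's transcendence input; the first open pairs are `{[2],[3]}`
    (`ζ(3)/π² ∉ ℚ`) and `{[2,3],[3,2]}` (§C).
* §C STRENGTH (why no proof is expected from present methods):
  - `zeta_five_ne_of_hoffmanIndependence` — the crux implies `ζ(5) ∉ ℚ·ζ(2)ζ(3)` (open), through the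
    weight-5 double-shuffle evaluations of `ζ(2,3)`, `ζ(3,2)` proved in the tree.
  (rattack-15045 Scratch.lean, evidence on the item, already derives `Irrational ζ(3)` and
  `ζ(2,3) ≠ ζ(3,2)` from the crux.)
* §D LINE `Sketch` (lead prover-line-…-15045-0; stubs `stub_motivicInput`, `stub_denseHoffmanCount` are
  the residual inputs, the five algebra stubs are landed p96408/p96416/p96446/p96499/p96713):
  - `stub_denseHoffmanCount` (C⁺) is crux-EQUIVALENT modulo the motivic input (lead: crux → C⁺ with
    `K = N`; C⁺ ∧ ∃M → crux) — not attackable separately; nothing to kill.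
  - `stub_motivicInput : ∃ M : Brown2012.MotivicMZV, IsDomain M.H` — JUNK-MODEL / CONSISTENCY PROBE
    (evidence `motivic_model_check.py` + `motivic_model_check.out` on the item): instantiate
    `H := 𝒰 = ℚ⟨f₃,f₅,…⟩ ⊗ ℚ[f₂]` (shuffle; a domain), `φ := id`, `dH r := dU r`, `per` := the real period
    character, and BUILD `J` weight by weight from the bundle's own axiom `dH_J` (Brown (3.4) with the
    tree's `Im/lft/inner/rgt/quot/dU/fU`), the free `fU N`-coordinate of `J v` being fixed by
    `per (J v) =` shuffle-regularised real `I(0;v;1)`. The bundle has this model iff every such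
    coordinate is RATIONAL. Result: ALL 2044 binary words of weight `2..10` get rational
    `𝒰`-coordinates (denominators ≤ 35568-ish, 95-digit numerics, tolerance 1e-40), and `J_nil`,
    `J_replicate`, `zetaOne` (n ≤ 4) hold EXACTLY in `𝒰`; deliberately flipping the I3 sign or the
    `per_J` word order makes 96 resp. 86 of the 252 words of weight ≤ 7 fail, so the probe has teeth.
    Hence no cheap kill of `stub_motivicInput`: the bundle is a faithful transcription through weight
    10 and its inhabitant is Brown's `H` (MT(ℤ), Goncharov 2005) — true in print, not constructible in
    the tree. By-product: Brown's decomposition `φ(ζᵐ(s))` for all `s` of weight ≤ 10 in the tree's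
    conventions (file `motivic_decompositions_w10.txt`), usable as exact-coefficient hints for
    `HoffmanSpanInKZ` (stmt-15044).
* §E NEAR-MISSES (sorried, this file only): the first open instances, isolated as clean targets.

Namespace note: lemmas §A–§C are mirrored sorry-free in
`Theorems/HoffmanIndependence/Negative/AlphabetMutations.lean` (p98970),
`…/Negative/DiagonalAndStrength.lean` (p100497) and `…/Negative/NotAlgebraicIndependent.lean` (p103460),
namespace `Summit.KontsevichZagierPeriods.HoffmanIndependence.Negative` (importable by ideators/planners).
-/

noncomputable section

set_option linter.dupNamespace false

namespace Summit.KontsevichZagierPeriods.KontsevichZagierPeriods.Cruxes.HoffmanIndependence.Disproof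

open scoped Nat
open Literature.NumberTheory.Transcendental MZV
open Summit.KontsevichZagierPeriods.KontsevichZagierPeriods.Theses.LinRedNormalForm (HoffmanIndependence)

/-! ## §A Load-bearing analysis: mutations of the alphabet `{2,3}` -/

/-- `HoffmanIndependenceWithoutNoOnes`: the crux with `IsHoffman` relaxed to `IsAdmissible`
(letter `1` allowed after the first position). -/
def WithoutNoOnes : Prop :=
  LinearIndependent ℚ (fun u : {u : List ℕ // IsAdmissible u} => multipleZeta u.1)

/-- **Relaxing `{2,3}` to all admissible indices is false**: Euler's `ζ(2,1) = ζ(3)` makes the family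
non-injective. Any proof of the crux must use "no letter `1`". [folklore] -/
theorem hoffmanIndependence_false_without_noOnes : ¬ WithoutNoOnes := by
  intro h
  have h21 : multipleZeta [2, 1] = multipleZeta [3] := euler_zeta_two_one_holds
  have hinj := h.injective
  have key := @hinj ⟨[2, 1], by decide⟩ ⟨[3], by decide⟩ (by simpa using h21)
  simp at key

/-- `HoffmanIndependenceWithoutNoFours`: the crux with `{2,3}` relaxed to "every entry `≥ 2`". -/
def WithoutNoLargeLetters : Prop :=
  LinearIndependent ℚ (fun u : {u : List ℕ // ∀ i ∈ u, 2 ≤ i} => multipleZeta u.1)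

/-- **Relaxing `{2,3}` to "all entries `≥ 2`" is false**: `4ζ(2,2) = 3ζ(4)` (`ζ(2,2) = π⁴/120`,
`ζ(4) = π⁴/90`). Any proof of the crux must use "no letter `≥ 4`". [folklore] -/
theorem hoffmanIndependence_false_without_noLargeLetters : ¬ WithoutNoLargeLetters := by
  intro h
  unfold WithoutNoLargeLetters at h
  rw [linearIndependent_iff'] at h
  let a : {u : List ℕ // ∀ i ∈ u, 2 ≤ i} := ⟨[2, 2], by decide⟩
  let b : {u : List ℕ // ∀ i ∈ u, 2 ≤ i} := ⟨[4], by decide⟩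
  have hab : a ≠ b := by simp [a, b]
  have key := h {a, b} (fun u => if u = a then 4 else -3) ?_ a (by simp)
  · simp at key
  · rw [Finset.sum_pair hab, if_pos rfl, if_neg hab.symm]
    simp only [a, b, multipleZeta_two_two, multipleZeta_four, Rat.smul_def]
    push_cast
    ring

/-- The alphabet `{2,4}` in place of `{2,3}`. -/
def TwoFourVariant : Prop :=
  LinearIndependent ℚ (fun u : {u : List ℕ // ∀ i ∈ u, i = 2 ∨ i = 4} => multipleZeta u.1)

/-- **Trading the letter `3` for `4` is false** (same witness `4ζ(2,2) = 3ζ(4)`). [folklore] -/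
theorem not_twoFourVariant : ¬ TwoFourVariant := by
  intro h
  unfold TwoFourVariant at h
  rw [linearIndependent_iff'] at h
  let a : {u : List ℕ // ∀ i ∈ u, i = 2 ∨ i = 4} := ⟨[2, 2], by decide⟩
  let b : {u : List ℕ // ∀ i ∈ u, i = 2 ∨ i = 4} := ⟨[4], by decide⟩
  have hab : a ≠ b := by simp [a, b]
  have key := h {a, b} (fun u => if u = a then 4 else -3) ?_ a (by simp)
  · simp at key
  · rw [Finset.sum_pair hab, if_pos rfl, if_neg hab.symm]
    simp only [a, b, multipleZeta_two_two, multipleZeta_four, Rat.smul_def]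
    push_cast
    ring

/-- The mirror alphabet: admissible words in the letters `{1,2}`. -/
def OneTwoVariant : Prop :=
  LinearIndependent ℚ (fun u : {u : List ℕ // IsAdmissible u ∧ ∀ i ∈ u, i = 1 ∨ i = 2} =>
    multipleZeta u.1)

/-- **The mirror alphabet `{1,2}` is false**: `3ζ(2,1,1) = 4ζ(2,2)` (`ζ(2,1,1) = ζ(4) = π⁴/90`).
(The duals of the Hoffman words form a conjectural basis too, but they are a proper subset of the
admissible `{1,2}`-words: `(2,1,1)` is the dual of `(4)`.) [folklore] -/
theorem not_oneTwoVariant : ¬ OneTwoVariant := by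
  intro h
  unfold OneTwoVariant at h
  rw [linearIndependent_iff'] at h
  let a : {u : List ℕ // IsAdmissible u ∧ ∀ i ∈ u, i = 1 ∨ i = 2} := ⟨[2, 1, 1], by decide⟩
  let b : {u : List ℕ // IsAdmissible u ∧ ∀ i ∈ u, i = 1 ∨ i = 2} := ⟨[2, 2], by decide⟩
  have hab : a ≠ b := by simp [a, b]
  have key := h {a, b} (fun u => if u = a then 3 else -4) ?_ a (by simp)
  · simp at key
  · rw [Finset.sum_pair hab, if_pos rfl, if_neg hab.symm]
    simp only [a, b, multipleZeta_two_two, multipleZeta_two_one_one, Rat.smul_def]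
    push_cast
    ring

/-- **The multiplicative strengthening is false**: the Hoffman values are NOT algebraically
independent over `ℚ` — `X_{(2)}² - (10/3)·X_{(2,2)}` vanishes at them (`ζ(2)² = π⁴/36 = (10/3)ζ(2,2)`)
and is non-zero (it takes the value `-10/3` at the rational point `X_{(2,2)} = 1`, all other
coordinates `0`). [folklore] -/
theorem hoffmanIndependence_false_algebraic :
    ¬ AlgebraicIndependent ℚ (fun u : {u : List ℕ // IsHoffman u} => multipleZeta u.1) := by
  classical
  intro h
  rw [algebraicIndependent_iff] at h
  let a : {u : List ℕ // IsHoffman u} := ⟨[2], by decide⟩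
  let b : {u : List ℕ // IsHoffman u} := ⟨[2, 2], by decide⟩
  have hab : a ≠ b := by simp [a, b]
  let p : MvPolynomial {u : List ℕ // IsHoffman u} ℚ :=
    MvPolynomial.X a * MvPolynomial.X a - MvPolynomial.C (10 / 3) * MvPolynomial.X b
  have hp : MvPolynomial.aeval (fun u : {u : List ℕ // IsHoffman u} => multipleZeta u.1) p = 0 := by
    simp only [p, map_sub, map_mul, MvPolynomial.aeval_X, MvPolynomial.aeval_C, a, b,
      multipleZeta_two, multipleZeta_two_two, eq_ratCast]
    push_cast
    ring
  have hp0 := h p hp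
  have := congrArg (MvPolynomial.eval fun u => if u = b then (1 : ℚ) else 0) hp0
  norm_num [p, hab] at this

/-! ## §B Tightness and boundary -/

/-- **Maximality through weight 9**: for every admissible NON-Hoffman index `s` of weight `≤ 9` the
enlarged family `{2,3}^× ∪ {s}` is `ℚ`-linearly DEPENDENT, because `ζ(s)` lies in the Hoffman span of
its weight (Brown's theorem, unconditional in the tree for weights `≤ 9`:
`multipleZeta_mem_hoffmanSpan_of_weight_le_nine`). So the crux is sharp: it asserts that the Hoffman
values are a BASIS of the MZV space (in weights ≤ 9 unconditionally; in general given
`hoffmanSpan_eq_mzvSpace`). [cite: Brown2012, Theorem 1.1] -/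
theorem not_linearIndependent_hoffman_insert {s : List ℕ} (hs : IsAdmissible s)
    (hns : ¬ IsHoffman s) (hw : weight s ≤ 9) :
    ¬ LinearIndependent ℚ (fun u : {u : List ℕ // IsHoffman u ∨ u = s} => multipleZeta u.1) := by
  intro h
  set i₀ : {u : List ℕ // IsHoffman u ∨ u = s} := ⟨s, Or.inr rfl⟩ with hi₀
  have hnot : i₀ ∉ {u : {u : List ℕ // IsHoffman u ∨ u = s} | u ≠ i₀} := by simp
  have hli := h.notMem_span_image hnot
  apply hli
  have hmem : multipleZeta s ∈ hoffmanSpan (weight s) :=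
    multipleZeta_mem_hoffmanSpan_of_weight_le_nine hs hw
  unfold hoffmanSpan at hmem
  refine Submodule.span_mono ?_ hmem
  rintro x ⟨t, ht, -, rfl⟩
  refine ⟨⟨t, Or.inl ht⟩, ?_, rfl⟩
  intro e
  have : t = s := congrArg Subtype.val (show (⟨t, Or.inl ht⟩ : {u : List ℕ // IsHoffman u ∨ u = s}) = i₀ from e)
  exact hns (this ▸ ht)

/-- The powers of a transcendental element are linearly independent (folklore; a local copy of
`CurveSmoothing.linearIndependent_pow_of_transcendental` to keep the imports in the periods cone).
[folklore] -/
theorem linearIndependent_pow_of_transcendental' {F E : Type*} [CommRing F] [Ring E]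
    [Algebra F E] {t : E} (ht : Transcendental F t) :
    LinearIndependent F (fun n : ℕ => t ^ n) := by
  classical
  rw [linearIndependent_iff']
  intro s g hsum n hn
  let p : Polynomial F := ∑ i ∈ s, Polynomial.monomial i (g i)
  have hp : Polynomial.aeval t p = 0 := by
    simp only [p, map_sum, Polynomial.aeval_monomial, ← Algebra.smul_def]
    exact hsum
  have hp0 : p = 0 := by
    by_contra h
    exact ht ⟨p, h, hp⟩
  have : p.coeff n = g n := by
    simp only [p, Polynomial.finsetSum_coeff, Polynomial.coeff_monomial]
    rw [Finset.sum_ite_eq' s n g]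
    simp [hn]
  rw [← this, hp0, Polynomial.coeff_zero]

/-- **The diagonal `{2}^×` of the crux is a theorem**: `ζ(2,…,2)` (`n` twos, `n ≥ 0`) are
`ℚ`-linearly independent, since `ζ({2}ⁿ) = π²ⁿ/(2n+1)!` (`multipleZeta_replicate_two`) and `π` is
transcendental (Lindemann, `transcendental_pi_holds`, proved in the tree). [cite: Hoffman1992, Corollary 2.3] -/
theorem linearIndependent_multipleZeta_replicate_two :
    LinearIndependent ℚ (fun n : ℕ => multipleZeta (List.replicate n 2)) := by
  have hpow : LinearIndependent ℚ (fun m : ℕ => Real.pi ^ m) :=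
    linearIndependent_pow_of_transcendental' transcendental_pi_holds
  have heven : LinearIndependent ℚ (fun n : ℕ => Real.pi ^ (2 * n)) :=
    hpow.comp (fun n : ℕ => 2 * n) (fun a b hab => by simpa using hab)
  have hunits := heven.units_smul (fun n => Units.mk0 (((2 * n + 1)! : ℕ) : ℚ)⁻¹
    (inv_ne_zero (by positivity)))
  convert hunits using 1
  funext n
  simp only [Pi.smul_apply', Units.smul_def, Units.val_mk0, multipleZeta_replicate_two, Rat.smul_def]
  push_cast
  ring

/-! ## §C Strength: the crux proves open irrationality statements -/

/-- **The crux implies `ζ(5) ∉ ℚ · ζ(2)ζ(3)`** (an open problem): with the weight-5 double-shuffle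
evaluations `ζ(2,3) = (9/2)ζ(5) - 2ζ(2)ζ(3)`, `ζ(3,2) = 3ζ(2)ζ(3) - (11/2)ζ(5)` (tree theorems), a
relation `ζ(5) = q ζ(2)ζ(3)` would make the two weight-5 Hoffman values `ζ(2,3)`, `ζ(3,2)`
proportional. So any proof of the crux proves this (and, weight by weight, every instance of the
period conjecture for MZVs). [cite: Zagier1994, §9] -/
theorem zeta_five_ne_of_hoffmanIndependence (h : HoffmanIndependence) (q : ℚ) :
    multipleZeta [5] ≠ (q : ℝ) * (multipleZeta [2] * multipleZeta [3]) := by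
  intro h5
  have h' : LinearIndependent ℚ (fun u : {u : List ℕ // IsHoffman u} => multipleZeta u.1) := h
  rw [linearIndependent_iff'] at h'
  let a : {u : List ℕ // IsHoffman u} := ⟨[2, 3], by decide⟩
  let b : {u : List ℕ // IsHoffman u} := ⟨[3, 2], by decide⟩
  have hab : a ≠ b := by simp [a, b]
  set P := multipleZeta [2] * multipleZeta [3] with hP
  have h23 : multipleZeta [2, 3] = ((9 / 2 * q - 2 : ℚ) : ℝ) * P := by
    rw [multipleZeta_two_three_eq, h5]; push_cast; ring
  have h32 : multipleZeta [3, 2] = ((3 - 11 / 2 * q : ℚ) : ℝ) * P := by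
    rw [multipleZeta_three_two_eq, h5]; push_cast; ring
  have key := h' {a, b} (fun u => if u = a then 3 - 11 / 2 * q else -(9 / 2 * q - 2)) ?_
  · have ha := key a (by simp)
    have hb := key b (by simp)
    rw [if_pos rfl] at ha
    rw [if_neg hab.symm] at hb
    linarith
  · rw [Finset.sum_pair hab, if_pos rfl, if_neg hab.symm]
    show ((3 - 11 / 2 * q : ℚ)) • multipleZeta [2, 3] + (-(9 / 2 * q - 2) : ℚ) • multipleZeta [3, 2] = 0
    rw [h23, h32, Rat.smul_def, Rat.smul_def]
    push_cast
    ring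

/-! ## §D Line `Sketch` — targets

No stub of the line is false as stated (see the module docstring): `stub_denseHoffmanCount` is
crux-equivalent modulo the motivic input, and `stub_motivicInput` survives the junk-model /
consistency probe through weight 10 (evidence files `motivic_model_check.py`, `.out`). Nothing to
record in Lean here beyond the trivial direction already landed by the lead. -/

/-! ## §E Near-misses: the first open instances (sorried ON PURPOSE — do not cite) -/

/-- NEAR-MISS (OPEN): weights `≤ 3` of the crux, `{1, ζ(2), ζ(3)}` independent, i.e.
`ζ(3) ∉ ℚ + ℚπ²`. Apéry (`Apery.irrational_zeta_three`, in the tree) gives only `ζ(3) ∉ ℚ`;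
`{1, ζ(2)}` and `{1, ζ(3)}` are the provable fragments. Obstruction: no simultaneous
approximations to `(ζ(2), ζ(3))` of the required quality are known (cf. crux NOTES: Apéry-companion
numerology, Dauguet–Zudilin). -/
theorem nearMiss_weight_le_three :
    LinearIndependent ℚ ![(1 : ℝ), multipleZeta [2], multipleZeta [3]] := by
  sorry

/-- NEAR-MISS (OPEN): the weight-5 slice `{ζ(2,3), ζ(3,2)}` independent `⟺ ζ(5) ∉ ℚ·ζ(2)ζ(3)`
(`zeta_five_ne_of_hoffmanIndependence` and its converse through the same two evaluations). Not even
`ζ(5) ∉ ℚ` is known. -/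
theorem nearMiss_weight_five :
    LinearIndependent ℚ ![multipleZeta [2, 3], multipleZeta [3, 2]] := by
  sorry

end Summit.KontsevichZagierPeriods.KontsevichZagierPeriods.Cruxes.HoffmanIndependence.Disproof
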